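import Summits.BirchSwinnertonDyer.BirchSwinnertonDyer.Theses.UniversalToricDescent
import HarnessLib

/-!
# Route UniversalToricDescent — closer of the glue 23784 `GoodSSApZeroTwinSupplyAtThreeGlue`
# (`GoodSSApZeroTwinSupplyOnTypeAtThree → GoodSSTwinForcesHessianTypeAtThree → GoodSSApZeroTwinSupplyAtThree`)

Prover bsd-wall-utd-p1 g8 (`--workitem stmt-BirchSwinnertonDyer-23784`; steward pss3x g0's split of the
`a₃ = 0` twin supply 23595 into the ON-TYPE supply (23782) and the OFF-TYPE residue (23783)). Trivial
composition: the residue puts the curve on the Hessian type, where the on-type supply applies. THEOREM ONLY;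
BSD is not advanced by this file. References: [Fisher2012Hessian] Thm. 13.2 (context only).
-/

set_option autoImplicit false
-- `…BirchSwinnertonDyer.BirchSwinnertonDyer.Theorems…` is the problem's mandated namespace (D-0017).
set_option linter.dupNamespace false

namespace Summit.BirchSwinnertonDyer.BirchSwinnertonDyer.Theorems

/-- **Item 23784 holds** (glue: on-type supply + type-forcing ⇒ supply on the cell). [folklore] -/
theorem goodSSApZeroTwinSupplyAtThreeGlue_proof :
    Summit.BirchSwinnertonDyer.BirchSwinnertonDyer.Theses.UniversalToricDescent.GoodSSApZeroTwinSupplyAtThreeGlue := by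
  intro hOn hTy W _ _ hO6 hr hsurj htwin
  obtain ⟨h4, h7⟩ := hTy W hO6 hr hsurj htwin
  exact hOn W hO6 h4 h7

end Summit.BirchSwinnertonDyer.BirchSwinnertonDyer.Theorems
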